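import Literature.NumberTheory.EllipticCurves.KrizLi2019.ThreeClassNumbers
import HarnessLib

/-!
# X12, `p = 3`, Kriz–Li corner beyond the window: the sixteen `3`-class-number conditions (3a), DECIDED IN THE KERNEL

HONEST FRAMING (cell `b2b-bsdres`, run/shared/lean/b2b/bsd-rank1-residual/; X12 prover owner
`b2b-bsdres-x1b`, gen 18): the goal is to DELETE the COMBINATION-SHAPED residual classes for ALL
analytic-rank `≤ 1` curves over `ℚ` — "full BSD formula for every rank `≤ 1` curve in class `C`"
assembled STRICTLY from published theorems — so that the rank-`≤ 1` remainder becomes exactly the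
CONSTRUCTION-SHAPED classes, which are TYPED (missing-input Props), NOT attempted; this is not
"finishing BSD". Class X12 stays CONSTRUCTION-SHAPED; the Kriz–Li sextic-twist corner at `p = 3` is
FAMILY-shaped. THEOREMS ONLY: no definition, NO new named fact (net Literature debt `0`). These are
our own kernel computations in the service of the cell's records, hence under `Summits/` (placement
rule 2026-08-19); the method and the thirteen window values are harvest-1's
`Literature/…/KrizLi2019/ThreeClassNumbers.lean` (`threeClassNumberTrivial_of_card`: `d_F = d₀` for a
quadratic `F ∋ √D`, `D = d₀ m²`; `h_F = h(d₀)` = the number of reduced primitive positive definite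
forms of discriminant `d₀`, Cox Thm. 7.7(ii); the count by `decide` over the sharp box `3a² ≤ |d₀|`).

The planner census `HOME/b2b-bsdres-hyp/hyp/ram3/RAM3-CENSUS.md` §3 (engines A ‖ P, 48/48 agree)
lists the 23 isogeny classes `N < 5·10⁵` of the X12 corner CM-by-`ℚ(√−3)` ∧ `r = 1` ∧ `p = 3` on which
EVERY binder of Kriz–Li 2019 Thm. 1.23 (= 10.10) + Cor. 10.7 (2) is met; 7 lie in the window
(`N < 2·10⁴`, records `SexticTwistFamily.bsdp_three_cremona<cls>_of_family`) and 16 beyond it. For the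
16, hypothesis (3a) of the family theorem `SexticTwistFamily.bsdp_three_sexticTwist_family` —
`h₃(−3d) = 1` for `d > 0`, `h₃(d) = 1` for `d < 0` — asks `ThreeClassNumberTrivial D` for

| class | `d` | `D` | `d₀`, `m` | `h(d₀)` | box `A` |
|---|---|---|---|---|---|
| 49923e | `−43` | `−43` | `−43, 1` | `1` | `3` |
| 52272bm | `44` | `−132` | `−132, 1` | `4` | `6` |
| 73008cn | `−52` | `−52` | `−52, 1` | `2` | `4` |
| 75843b | `53` | `−159` | `−159, 1` | `10` | `7` |
| 87723n | `57` | `−171` | `−19, 3` | `1` | `2` |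
| 97344a | `104` | `−312` | `−312, 1` | `4` | `10` |
| 168507b | `−79` | `−79` | `−79, 1` | `5` | `5` |
| 176400jw | `140` | `−420` | `−420, 1` | `8` | `11` |
| 199809a | `149` | `−447` | `−447, 1` | `14` | `12` |
| 209088ex | `−88` | `−88` | `−88, 1` | `2` | `5` |
| 213867k | `89` | `−267` | `−267, 1` | `2` | `9` |
| 308025bp | `185` | `−555` | `−555, 1` | `4` | `13` |
| 357075be | `−115` | `−115` | `−115, 1` | `2` | `6` |
| 388800fg | `120` | `−360` | `−40, 3` | `2` | `3` |
| 439569bl | `221` | `−663` | `−663, 1` | `16` | `14` |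
| 449307j | `129` | `−387` | `−43, 3` | `1` | `3` |

— none of the class numbers is divisible by `3` (the same values as hyp's two engines, column `h_d`).

## References
* [KrizLi2019] D. Kriz, C. Li, Forum Math. Sigma 7 (2019) e15, Thm. 1.23 (hypothesis (3), notation `h₃(D)`).
* [Cox2013] D. A. Cox, *Primes of the form x² + ny²*, 2nd ed., §2.A (2.12), Thm. 2.13; §7.B Thm. 7.7(ii).
* HOME/b2b-bsdres-hyp/hyp/ram3/RAM3-CENSUS.md §3 (T-KL table); HOME/b2b-bsdres-x1b/X12-ROUTE.md §22.
-/

open scoped Classical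

open Literature.NumberTheory.QuadraticFields.BinaryQuadraticForm
open Literature.NumberTheory.EllipticCurves.KrizLi2019

namespace Summit.BirchSwinnertonDyer.Rank1Residual.X12.SexticTwistFamily

/-- `h(−43) = 1` ⇒ `h₃(−43) = 1`. [cite: Cox2013, §2.A Thm. 2.13 and §7.B Thm. 7.7(ii)] -/
theorem threeClassNumberTrivial_neg43 : ThreeClassNumberTrivial (-43) :=
  threeClassNumberTrivial_of_card (d₀ := -43) (m := 1) 3 1
    (Or.inl ⟨by decide, by simpa using squarefree_neg_natCast (by norm_num : Nat.Prime 43).squarefree, by decide⟩)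
    one_ne_zero (by norm_num) (by norm_num) (by norm_num) (by decide +kernel) (by decide)

/-- `h(−132) = 4` (`−132 = 4·(−33)`) ⇒ `h₃(−132) = 1`. [cite: Cox2013, §2.A Thm. 2.13 and §7.B Thm. 7.7(ii)] -/
theorem threeClassNumberTrivial_neg132 : ThreeClassNumberTrivial (-132) :=
  threeClassNumberTrivial_of_card (d₀ := -132) (m := 1) 6 4
    (Or.inr ⟨by decide, by decide, by
      rw [show ((-132 : ℤ) / 4) = -33 by norm_num]
      simpa using squarefree_neg_natCast (squarefree_mul_of_prime Nat.prime_three (by norm_num : Nat.Prime 11) (by decide))⟩)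
    one_ne_zero (by norm_num) (by norm_num) (by norm_num) (by decide +kernel) (by decide)

/-- `h(−52) = 2` (`−52 = 4·(−13)`) ⇒ `h₃(−52) = 1`. [cite: Cox2013, §2.A Thm. 2.13 and §7.B Thm. 7.7(ii)] -/
theorem threeClassNumberTrivial_neg52 : ThreeClassNumberTrivial (-52) :=
  threeClassNumberTrivial_of_card (d₀ := -52) (m := 1) 4 2
    (Or.inr ⟨by decide, by decide, by
      rw [show ((-52 : ℤ) / 4) = -13 by norm_num]
      simpa using squarefree_neg_natCast (by norm_num : Nat.Prime 13).squarefree⟩)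
    one_ne_zero (by norm_num) (by norm_num) (by norm_num) (by decide +kernel) (by decide)

/-- `h(−159) = 10` (`159 = 3·53`) ⇒ `h₃(−159) = 1`. [cite: Cox2013, §2.A Thm. 2.13 and §7.B Thm. 7.7(ii)] -/
theorem threeClassNumberTrivial_neg159 : ThreeClassNumberTrivial (-159) :=
  threeClassNumberTrivial_of_card (d₀ := -159) (m := 1) 7 10
    (Or.inl ⟨by decide, by simpa using squarefree_neg_natCast (squarefree_mul_of_prime Nat.prime_three (by norm_num : Nat.Prime 53) (by decide)), by decide⟩)
    one_ne_zero (by norm_num) (by norm_num) (by norm_num) (by decide +kernel) (by decide)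

/-- `h(−19) = 1` and `−171 = −19·3²` ⇒ `h₃(−171) = 1` (the field is `ℚ(√−19)`). [cite: Cox2013, §2.A Thm. 2.13 and §7.B Thm. 7.7(ii)] -/
theorem threeClassNumberTrivial_neg171 : ThreeClassNumberTrivial (-171) :=
  threeClassNumberTrivial_of_card (d₀ := -19) (m := 3) 2 1
    (Or.inl ⟨by decide, by simpa using squarefree_neg_natCast (by norm_num : Nat.Prime 19).squarefree, by decide⟩)
    (by norm_num) (by norm_num) (by norm_num) (by norm_num) (by decide +kernel) (by decide)

/-- `h(−312) = 4` (`−312 = 4·(−78)`, `78 = 2·3·13`) ⇒ `h₃(−312) = 1`. [cite: Cox2013, §2.A Thm. 2.13 and §7.B Thm. 7.7(ii)] -/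
theorem threeClassNumberTrivial_neg312 : ThreeClassNumberTrivial (-312) :=
  threeClassNumberTrivial_of_card (d₀ := -312) (m := 1) 10 4
    (Or.inr ⟨by decide, by decide, by
      rw [show ((-312 : ℤ) / 4) = -78 by norm_num]
      simpa using squarefree_neg_natCast (squarefree_mul_mul_of_prime Nat.prime_two Nat.prime_three (by norm_num : Nat.Prime 13) (by decide) (by decide) (by decide))⟩)
    one_ne_zero (by norm_num) (by norm_num) (by norm_num) (by decide +kernel) (by decide)

/-- `h(−79) = 5` ⇒ `h₃(−79) = 1`. [cite: Cox2013, §2.A Thm. 2.13 and §7.B Thm. 7.7(ii)] -/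
theorem threeClassNumberTrivial_neg79 : ThreeClassNumberTrivial (-79) :=
  threeClassNumberTrivial_of_card (d₀ := -79) (m := 1) 5 5
    (Or.inl ⟨by decide, by simpa using squarefree_neg_natCast (by norm_num : Nat.Prime 79).squarefree, by decide⟩)
    one_ne_zero (by norm_num) (by norm_num) (by norm_num) (by decide +kernel) (by decide)

/-- `h(−420) = 8` (`−420 = 4·(−105)`, `105 = 3·5·7`) ⇒ `h₃(−420) = 1`. [cite: Cox2013, §2.A Thm. 2.13 and §7.B Thm. 7.7(ii)] -/
theorem threeClassNumberTrivial_neg420 : ThreeClassNumberTrivial (-420) :=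
  threeClassNumberTrivial_of_card (d₀ := -420) (m := 1) 11 8
    (Or.inr ⟨by decide, by decide, by
      rw [show ((-420 : ℤ) / 4) = -105 by norm_num]
      simpa using squarefree_neg_natCast (squarefree_mul_mul_of_prime Nat.prime_three Nat.prime_five (by norm_num : Nat.Prime 7) (by decide) (by decide) (by decide))⟩)
    one_ne_zero (by norm_num) (by norm_num) (by norm_num) (by decide +kernel) (by decide)

/-- `h(−447) = 14` (`447 = 3·149`) ⇒ `h₃(−447) = 1`. [cite: Cox2013, §2.A Thm. 2.13 and §7.B Thm. 7.7(ii)] -/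
theorem threeClassNumberTrivial_neg447 : ThreeClassNumberTrivial (-447) :=
  threeClassNumberTrivial_of_card (d₀ := -447) (m := 1) 12 14
    (Or.inl ⟨by decide, by simpa using squarefree_neg_natCast (squarefree_mul_of_prime Nat.prime_three (by norm_num : Nat.Prime 149) (by decide)), by decide⟩)
    one_ne_zero (by norm_num) (by norm_num) (by norm_num) (by decide +kernel) (by decide)

/-- `h(−88) = 2` (`−88 = 4·(−22)`) ⇒ `h₃(−88) = 1`. [cite: Cox2013, §2.A Thm. 2.13 and §7.B Thm. 7.7(ii)] -/
theorem threeClassNumberTrivial_neg88 : ThreeClassNumberTrivial (-88) :=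
  threeClassNumberTrivial_of_card (d₀ := -88) (m := 1) 5 2
    (Or.inr ⟨by decide, by decide, by
      rw [show ((-88 : ℤ) / 4) = -22 by norm_num]
      simpa using squarefree_neg_natCast (squarefree_mul_of_prime Nat.prime_two (by norm_num : Nat.Prime 11) (by decide))⟩)
    one_ne_zero (by norm_num) (by norm_num) (by norm_num) (by decide +kernel) (by decide)

/-- `h(−267) = 2` (`267 = 3·89`) ⇒ `h₃(−267) = 1`. [cite: Cox2013, §2.A Thm. 2.13 and §7.B Thm. 7.7(ii)] -/
theorem threeClassNumberTrivial_neg267 : ThreeClassNumberTrivial (-267) :=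
  threeClassNumberTrivial_of_card (d₀ := -267) (m := 1) 9 2
    (Or.inl ⟨by decide, by simpa using squarefree_neg_natCast (squarefree_mul_of_prime Nat.prime_three (by norm_num : Nat.Prime 89) (by decide)), by decide⟩)
    one_ne_zero (by norm_num) (by norm_num) (by norm_num) (by decide +kernel) (by decide)

/-- `h(−555) = 4` (`555 = 3·5·37`) ⇒ `h₃(−555) = 1`. [cite: Cox2013, §2.A Thm. 2.13 and §7.B Thm. 7.7(ii)] -/
theorem threeClassNumberTrivial_neg555 : ThreeClassNumberTrivial (-555) :=
  threeClassNumberTrivial_of_card (d₀ := -555) (m := 1) 13 4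
    (Or.inl ⟨by decide, by simpa using squarefree_neg_natCast (squarefree_mul_mul_of_prime Nat.prime_three Nat.prime_five (by norm_num : Nat.Prime 37) (by decide) (by decide) (by decide)), by decide⟩)
    one_ne_zero (by norm_num) (by norm_num) (by norm_num) (by decide +kernel) (by decide)

/-- `h(−115) = 2` (`115 = 5·23`) ⇒ `h₃(−115) = 1`. [cite: Cox2013, §2.A Thm. 2.13 and §7.B Thm. 7.7(ii)] -/
theorem threeClassNumberTrivial_neg115 : ThreeClassNumberTrivial (-115) :=
  threeClassNumberTrivial_of_card (d₀ := -115) (m := 1) 6 2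
    (Or.inl ⟨by decide, by simpa using squarefree_neg_natCast (squarefree_mul_of_prime Nat.prime_five (by norm_num : Nat.Prime 23) (by decide)), by decide⟩)
    one_ne_zero (by norm_num) (by norm_num) (by norm_num) (by decide +kernel) (by decide)

/-- `h(−40) = 2` and `−360 = −40·3²` (`−40 = 4·(−10)`) ⇒ `h₃(−360) = 1` (the field is `ℚ(√−10)`).
[cite: Cox2013, §2.A Thm. 2.13 and §7.B Thm. 7.7(ii)] -/
theorem threeClassNumberTrivial_neg360 : ThreeClassNumberTrivial (-360) :=
  threeClassNumberTrivial_of_card (d₀ := -40) (m := 3) 3 2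
    (Or.inr ⟨by decide, by decide, by
      rw [show ((-40 : ℤ) / 4) = -10 by norm_num]
      simpa using squarefree_neg_natCast (squarefree_mul_of_prime Nat.prime_two Nat.prime_five (by decide))⟩)
    (by norm_num) (by norm_num) (by norm_num) (by norm_num) (by decide +kernel) (by decide)

/-- `h(−663) = 16` (`663 = 3·13·17`) ⇒ `h₃(−663) = 1`. [cite: Cox2013, §2.A Thm. 2.13 and §7.B Thm. 7.7(ii)] -/
theorem threeClassNumberTrivial_neg663 : ThreeClassNumberTrivial (-663) :=
  threeClassNumberTrivial_of_card (d₀ := -663) (m := 1) 14 16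
    (Or.inl ⟨by decide, by simpa using squarefree_neg_natCast (squarefree_mul_mul_of_prime Nat.prime_three (by norm_num : Nat.Prime 13) (by norm_num : Nat.Prime 17) (by decide) (by decide) (by decide)), by decide⟩)
    one_ne_zero (by norm_num) (by norm_num) (by norm_num) (by decide +kernel) (by decide)

/-- `h(−43) = 1` and `−387 = −43·3²` ⇒ `h₃(−387) = 1` (the field is `ℚ(√−43)`). [cite: Cox2013, §2.A Thm. 2.13 and §7.B Thm. 7.7(ii)] -/
theorem threeClassNumberTrivial_neg387 : ThreeClassNumberTrivial (-387) :=
  threeClassNumberTrivial_of_card (d₀ := -43) (m := 3) 3 1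
    (Or.inl ⟨by decide, by simpa using squarefree_neg_natCast (by norm_num : Nat.Prime 43).squarefree, by decide⟩)
    (by norm_num) (by norm_num) (by norm_num) (by norm_num) (by decide +kernel) (by decide)

end Summit.BirchSwinnertonDyer.Rank1Residual.X12.SexticTwistFamily
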